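import Mathlib
import Summits.AtomisticToContinuum.FouriersLaw.Theorems.EmbeddedDrudeMourreMourreDissolutionFibreDictionary
import Summits.AtomisticToContinuum.FouriersLaw.Theorems.EmbeddedDrudeMourreKineticConductivityFiniteMeasurable
import Summits.AtomisticToContinuum.FouriersLaw.Theorems.EmbeddedDrudeMourreMourreDissolutionLevelShiftPushforward
import HarnessLib

/-!
# Fermi's golden rule at threshold by dominated convergence — `stub_thresholdFGR_of` (stub LIM) of line `swap-odd-threshold-rigidity`
(crux `EmbeddedDrudeMourre.MourreDissolution`, item stmt-AtomisticToContinuum-12594; helper file, `--supports`)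

Registered stub LIM of the checked skeleton of line `swap-odd-threshold-rigidity` (lead c8), in the
skeleton's stub namespace `Summit.AtomisticToContinuum.FouriersLaw.Theorems.MourreDissolution`:
the implication `DOM → FGR`.

Notation: pinned band `ω = dispersion ω₂` (`ω₂ > 0`), weight `W = Φ²/(ω₁ω₂ω₃ω₄)²·[f]²`
(`Φ = vertex a b`, `[f] = f(k₁)+f(k₂)−f(k₃)−f(k₁+k₂−k₃)`), resonance function `Ω = resonanceFn ω₂`,
cell `(−π,π]`, fibre Poisson integrals `I_ν(k₁,k₃) = ∫_{k₂ ∈ cell} W · ν/(Ω² + ν²)`.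

* DOM (hypothesis; the neighbouring stub `stub_fibreDomination`): a constant `M` bounds `I_ν(k₁,k₃)`
  for all `ν > 0` and all cell fibres with `sin((k₃−k₁)/2) ≠ 0` and `v(k₃) ≠ v(k₁)`.
* FGR (conclusion): for `2π`-periodic `C²` profiles `f` with `q(f) < ∞`,
  `∫_{k₁} ∫_{k₃} I_ν(k₁,k₃) → (4π/alsPrefactor) · q(f)` as `ν ↓ 0`, `q = boltzmannForm ω₂ a b f`.

Proof (pure measure theory). On the finite measure space `cell²`:
1. a.e. fibre is good (`ae_goodFibre`) and on a good fibre `I_ν → (π/alsPrefactor) Σᶠ_{resonantSet}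
   collisionWeight·[f]²` (`tendsto_fibre_lorentzian_resonantSet`, the fibre dictionary);
2. on a good fibre `k₁ ≠ k₃` (so `sin((k₃−k₁)/2) ≠ 0`) and the exchange zero `k₂ = k₃` is simple
   (so `v(k₃) ≠ v(k₁)`), whence DOM gives `0 ≤ I_ν ≤ M` a.e., uniformly in `ν > 0`;
3. `I_ν` is measurable on `cell²`: the integrand is continuous on `ℝ³` for `ν > 0`, hence integrable
   on `cell² × cell`, and Fubini (`Integrable.integral_prod_left`, `integral_prod`) also converts the
   iterated integral `∫_{k₁}∫_{k₃}` into the integral over `cell²`;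
4. dominated convergence along the filter `𝓝[>] 0`
   (`tendsto_integral_filter_of_dominated_convergence`);
5. the limit integral is `(π/alsPrefactor) · ∫_{cell²} Σᶠ… = (π/alsPrefactor) · 4 q(f)`: the fibre
   sum agrees on the cell with a measurable function (`KineticConductivityFinite.exists_measurable_repr`),
   so its Bochner integral is the `toReal` of the (product, then iterated: `lintegral_prod`) lower
   integral defining `q`.
No cited facts.
-/

noncomputable section

namespace Summit.AtomisticToContinuum.FouriersLaw.Theorems.MourreDissolution

open MeasureTheory Filter Set Function Topology Real
open scoped ENNReal
open Literature.MathematicalPhysics.KineticTheory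
open Literature.MathematicalPhysics.KineticTheory.PhononBoltzmann

/-! ### Fubini on the cell `(−π,π]³`, bracketed as `((k₁, k₃), k₂)` -/

/-- A continuous function on `(ℝ × ℝ) × ℝ` is integrable over the cell `(−π,π]³` written as the
product `(dk₁ dk₃) dk₂` of restricted Lebesgue measures (the product of the restrictions is the
restriction of Lebesgue measure to the bounded cube, which sits in the compact closed cube).
[folklore] -/
theorem thresholdFGR_integrable_cell3 {G : (ℝ × ℝ) × ℝ → ℝ} (hG : Continuous G) :
    Integrable G (((volume.restrict (Ioc (-π) π)).prod (volume.restrict (Ioc (-π) π))).prod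
      (volume.restrict (Ioc (-π) π))) := by
  rw [Measure.prod_restrict, Measure.prod_restrict]
  have hK : IsCompact ((Icc (-π) π ×ˢ Icc (-π) π) ×ˢ Icc (-π) π : Set ((ℝ × ℝ) × ℝ)) :=
    (isCompact_Icc.prod isCompact_Icc).prod isCompact_Icc
  exact (hG.continuousOn.integrableOn_compact hK).mono_set
    (prod_mono (prod_mono Ioc_subset_Icc_self Ioc_subset_Icc_self) Ioc_subset_Icc_self)

/-- For continuous `G` on `(ℝ × ℝ) × ℝ`, the fibre integral `p ↦ ∫_{k₂ ∈ cell} G(p, k₂)` is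
integrable (in particular a.e.-strongly measurable) on the cell `(−π,π]²`. [folklore] -/
theorem thresholdFGR_integrable_fibre {G : (ℝ × ℝ) × ℝ → ℝ} (hG : Continuous G) :
    Integrable (fun p : ℝ × ℝ => ∫ k₂ in Ioc (-π) π, G (p, k₂))
      (volume.restrict (Ioc (-π) π ×ˢ Ioc (-π) π)) := by
  rw [Measure.volume_eq_prod, ← Measure.prod_restrict]
  exact (thresholdFGR_integrable_cell3 hG).integral_prod_left

/-- Fubini on the cell for continuous `G` on `(ℝ × ℝ) × ℝ`: the iterated integral
`∫ dk₁ ∫ dk₃ ∫ dk₂ G((k₁,k₃),k₂)` over `(−π,π]` in each variable is the integral over the cell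
`(−π,π]²` of the fibre integrals `p ↦ ∫ dk₂ G(p,k₂)`. [folklore] -/
theorem thresholdFGR_integral_cell3 {G : (ℝ × ℝ) × ℝ → ℝ} (hG : Continuous G) :
    ∫ k₁ in Ioc (-π) π, ∫ k₃ in Ioc (-π) π, ∫ k₂ in Ioc (-π) π, G ((k₁, k₃), k₂) =
      ∫ p in Ioc (-π) π ×ˢ Ioc (-π) π, ∫ k₂ in Ioc (-π) π, G (p, k₂) := by
  rw [Measure.volume_eq_prod, ← Measure.prod_restrict,
    integral_prod _ (thresholdFGR_integrable_cell3 hG).integral_prod_left]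

/-- The cell `(−π,π]²` has finite Lebesgue measure. [folklore] -/
theorem thresholdFGR_isFiniteMeasure_cell2 :
    IsFiniteMeasure (volume.restrict (Ioc (-π) π ×ˢ Ioc (-π) π) : Measure (ℝ × ℝ)) := by
  rw [Measure.volume_eq_prod, ← Measure.prod_restrict]
  infer_instance

/-! ### The regularised integrand is continuous for `ν > 0` -/

/-- For `ω₂ > 0`, continuous `f` and `ν > 0`, the Lorentzian-regularised weighted integrand
`W · ν/(Ω² + ν²)`, read at `((k₁, k₃), k₂)`, is continuous on `(ℝ × ℝ) × ℝ` (the band is gapped,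
so `(ω₁ω₂ω₃ω₄)² ≠ 0`, and `Ω² + ν² > 0`). [folklore] -/
theorem thresholdFGR_continuous_integrand {ω₂ : ℝ} (hω : 0 < ω₂) (a b : ℝ) {f : ℝ → ℝ}
    (hf : Continuous f) {ν : ℝ} (hν : 0 < ν) :
    Continuous fun q : (ℝ × ℝ) × ℝ =>
      vertex a b q.1.1 q.2 q.1.2 ^ 2 /
          (dispersion ω₂ q.1.1 * dispersion ω₂ q.2 * dispersion ω₂ q.1.2 *
            dispersion ω₂ (q.1.1 + q.2 - q.1.2)) ^ 2 *
        (f q.1.1 + f q.2 - f q.1.2 - f (q.1.1 + q.2 - q.1.2)) ^ 2 *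
        (ν / (resonanceFn ω₂ q.1.1 q.2 q.1.2 ^ 2 + ν ^ 2)) := by
  have hden : ∀ q : (ℝ × ℝ) × ℝ, (dispersion ω₂ q.1.1 * dispersion ω₂ q.2 * dispersion ω₂ q.1.2 *
      dispersion ω₂ (q.1.1 + q.2 - q.1.2)) ^ 2 ≠ 0 := fun q =>
    pow_ne_zero _ (mul_pos (mul_pos (mul_pos (dispersion_pos hω _) (dispersion_pos hω _))
      (dispersion_pos hω _)) (dispersion_pos hω _)).ne'
  have hV : Continuous fun q : (ℝ × ℝ) × ℝ => vertex a b q.1.1 q.2 q.1.2 ^ 2 := by fun_prop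
  have hD : Continuous fun q : (ℝ × ℝ) × ℝ => (dispersion ω₂ q.1.1 * dispersion ω₂ q.2 *
      dispersion ω₂ q.1.2 * dispersion ω₂ (q.1.1 + q.2 - q.1.2)) ^ 2 := by fun_prop
  have hB : Continuous fun q : (ℝ × ℝ) × ℝ =>
      (f q.1.1 + f q.2 - f q.1.2 - f (q.1.1 + q.2 - q.1.2)) ^ 2 := by fun_prop
  have hP : Continuous fun q : (ℝ × ℝ) × ℝ => ν / (resonanceFn ω₂ q.1.1 q.2 q.1.2 ^ 2 + ν ^ 2) :=
    continuous_const.div (by fun_prop) fun q => by positivity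
  exact ((hV.div hD hden).mul hB).mul hP

/-! ### Identification of the limit: the resolved form as a Bochner integral over the cell -/

/-- A non-negative function on `ℝ²` which agrees on the cell `(−π,π]²` with a measurable function has
Bochner integral over the cell equal to the real part of the iterated lower integral `∫⁻dk₁ ∫⁻dk₃`.
[folklore] -/
theorem thresholdFGR_integral_eq_toReal_lintegral {S Mr : ℝ × ℝ → ℝ} (hMr : Measurable Mr)
    (hS : ∀ k₁ ∈ Ioc (-π) π, ∀ k₃ ∈ Ioc (-π) π, S (k₁, k₃) = Mr (k₁, k₃)) (hS0 : ∀ p, 0 ≤ S p) :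
    ∫ p in Ioc (-π) π ×ˢ Ioc (-π) π, S p =
      (∫⁻ k₁ in Ioc (-π) π, ∫⁻ k₃ in Ioc (-π) π, ENNReal.ofReal (S (k₁, k₃))).toReal := by
  have hcell : MeasurableSet (Ioc (-π) π ×ˢ Ioc (-π) π : Set (ℝ × ℝ)) :=
    measurableSet_Ioc.prod measurableSet_Ioc
  have hae : S =ᵐ[volume.restrict (Ioc (-π) π ×ˢ Ioc (-π) π)] Mr := by
    filter_upwards [ae_restrict_mem hcell] with p hp
    rw [mem_prod] at hp
    exact hS p.1 hp.1 p.2 hp.2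
  rw [integral_eq_lintegral_of_nonneg_ae (ae_of_all _ hS0)
    (hMr.aestronglyMeasurable.congr hae.symm)]
  have hm : AEMeasurable (fun p => ENNReal.ofReal (S p))
      (volume.restrict (Ioc (-π) π ×ˢ Ioc (-π) π)) :=
    (ENNReal.measurable_ofReal.comp hMr).aemeasurable.congr (hae.symm.fun_comp ENNReal.ofReal)
  rw [Measure.volume_eq_prod, ← Measure.prod_restrict] at hm ⊢
  rw [lintegral_prod _ hm]

/-- **The resolved form as a Bochner integral.** For `ω₂ > 0` and measurable `f`, the Bochner
integral over the cell `(−π,π]²` of the fibre sums `Σᶠ_{k₂ ∈ resonantSet} collisionWeight · [f]²`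
equals `4 · q(f).toReal`, `q = boltzmannForm ω₂ a b f` (both sides vanish when `q = ∞`).
[folklore] -/
theorem thresholdFGR_integral_finsum {ω₂ : ℝ} (hω : 0 < ω₂) (a b : ℝ) {f : ℝ → ℝ}
    (hf : Measurable f) :
    ∫ p in Ioc (-π) π ×ˢ Ioc (-π) π, (∑ᶠ k₂ ∈ resonantSet ω₂ p.1 p.2,
        collisionWeight ω₂ a b p.1 k₂ p.2 * (f p.1 + f k₂ - f p.2 - f (p.1 + k₂ - p.2)) ^ 2) =
      4 * (boltzmannForm ω₂ a b f).toReal := by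
  obtain ⟨Mr, hMr, hS⟩ := KineticConductivityFinite.exists_measurable_repr hω a b hf
  rw [thresholdFGR_integral_eq_toReal_lintegral (S := fun p : ℝ × ℝ => ∑ᶠ k₂ ∈ resonantSet ω₂ p.1 p.2,
      collisionWeight ω₂ a b p.1 k₂ p.2 * (f p.1 + f k₂ - f p.2 - f (p.1 + k₂ - p.2)) ^ 2) hMr hS
    (fun p => finsum_nonneg fun k₂ => finsum_nonneg fun _ =>
      mul_nonneg (collisionWeight_nonneg ω₂ a b p.1 k₂ p.2) (sq_nonneg _))]
  unfold boltzmannForm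
  rw [ENNReal.toReal_mul, ENNReal.toReal_ofReal (by norm_num : (0 : ℝ) ≤ 1 / 4)]
  ring

/-! ### The registered stub -/

/-- **Stub LIM of line `swap-odd-threshold-rigidity` (`stub_thresholdFGR_of`): Fermi's golden rule at
threshold from the fibre domination.** If the fibre Poisson integrals
`I_ν(k₁,k₃) = ∫_{k₂ ∈ cell} W · ν/(Ω² + ν²)` are bounded by a constant on all cell fibres with
`sin((k₃−k₁)/2) ≠ 0`, `v(k₃) ≠ v(k₁)`, uniformly in `ν > 0` (DOM), then for `ω₂ > 0` and every
`2π`-periodic `C²` profile `f` with `q(f) < ∞`,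
`∫_{k₁}∫_{k₃} I_ν → (4π/alsPrefactor) · q(f)` as `ν ↓ 0` — dominated convergence over the fibre
dictionary on the finite measure space `cell²`, a.e. fibre being good. [folklore] -/
theorem stub_thresholdFGR_of :
    (∀ ω₂ a b : ℝ, 0 < ω₂ → ∀ f : ℝ → ℝ, Function.Periodic f (2 * Real.pi) → ContDiff ℝ 2 f →
      ∃ M : ℝ, ∀ k₁ k₃ : ℝ, k₁ ∈ Set.Ioc (-Real.pi) Real.pi → k₃ ∈ Set.Ioc (-Real.pi) Real.pi →
        Real.sin ((k₃ - k₁) / 2) ≠ 0 → groupVelocity ω₂ k₃ ≠ groupVelocity ω₂ k₁ → ∀ ν : ℝ, 0 < ν →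
          (∫ k₂ in Set.Ioc (-Real.pi) Real.pi,
              vertex a b k₁ k₂ k₃ ^ 2 /
                  (dispersion ω₂ k₁ * dispersion ω₂ k₂ * dispersion ω₂ k₃ * dispersion ω₂ (k₁ + k₂ - k₃)) ^ 2 *
                (f k₁ + f k₂ - f k₃ - f (k₁ + k₂ - k₃)) ^ 2 *
                (ν / (resonanceFn ω₂ k₁ k₂ k₃ ^ 2 + ν ^ 2))) ≤ M) →
    ∀ ω₂ a b : ℝ, 0 < ω₂ → ∀ f : ℝ → ℝ, Function.Periodic f (2 * Real.pi) → ContDiff ℝ 2 f →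
      boltzmannForm ω₂ a b f < ⊤ →
      Tendsto
        (fun ν : ℝ => ∫ k₁ in Set.Ioc (-Real.pi) Real.pi, ∫ k₃ in Set.Ioc (-Real.pi) Real.pi,
          ∫ k₂ in Set.Ioc (-Real.pi) Real.pi,
            vertex a b k₁ k₂ k₃ ^ 2 /
                (dispersion ω₂ k₁ * dispersion ω₂ k₂ * dispersion ω₂ k₃ * dispersion ω₂ (k₁ + k₂ - k₃)) ^ 2 *
              (f k₁ + f k₂ - f k₃ - f (k₁ + k₂ - k₃)) ^ 2 *
              (ν / (resonanceFn ω₂ k₁ k₂ k₃ ^ 2 + ν ^ 2)))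
        (𝓝[>] (0 : ℝ)) (𝓝 (4 * Real.pi / alsPrefactor * (boltzmannForm ω₂ a b f).toReal)) := by
  intro hDOM ω₂ a b hω f hper hf _hq
  obtain ⟨M, hM⟩ := hDOM ω₂ a b hω f hper hf
  have hfc : Continuous f := hf.continuous
  haveI := thresholdFGR_isFiniteMeasure_cell2
  have hcell : MeasurableSet (Ioc (-π) π ×ˢ Ioc (-π) π : Set (ℝ × ℝ)) :=
    measurableSet_Ioc.prod measurableSet_Ioc
  -- the fibre Poisson integrals `I ν (k₁, k₃)` and their fibrewise limit `I₀`
  set I : ℝ → ℝ × ℝ → ℝ := fun ν p => ∫ k₂ in Ioc (-π) π,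
      vertex a b p.1 k₂ p.2 ^ 2 /
          (dispersion ω₂ p.1 * dispersion ω₂ k₂ * dispersion ω₂ p.2 * dispersion ω₂ (p.1 + k₂ - p.2)) ^ 2 *
        (f p.1 + f k₂ - f p.2 - f (p.1 + k₂ - p.2)) ^ 2 *
        (ν / (resonanceFn ω₂ p.1 k₂ p.2 ^ 2 + ν ^ 2)) with hI_def
  set I₀ : ℝ × ℝ → ℝ := fun p => π / alsPrefactor * ∑ᶠ k₂ ∈ resonantSet ω₂ p.1 p.2,
      collisionWeight ω₂ a b p.1 k₂ p.2 * (f p.1 + f k₂ - f p.2 - f (p.1 + k₂ - p.2)) ^ 2 with hI₀_def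
  -- (3) Fubini: the iterated integral is the integral of `I ν` over the cell², and `I ν` is measurable
  have h_fub : ∀ ν, 0 < ν → (∫ k₁ in Ioc (-π) π, ∫ k₃ in Ioc (-π) π, I ν (k₁, k₃)) =
      ∫ p in Ioc (-π) π ×ˢ Ioc (-π) π, I ν p := fun ν hν =>
    thresholdFGR_integral_cell3 (thresholdFGR_continuous_integrand hω a b hfc hν)
  have h_meas : ∀ ν, 0 < ν → AEStronglyMeasurable (I ν) (volume.restrict (Ioc (-π) π ×ˢ Ioc (-π) π)) :=
    fun ν hν => (thresholdFGR_integrable_fibre (thresholdFGR_continuous_integrand hω a b hfc hν)).1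
  -- (2) domination, a.e. on the cell² (good fibres), uniformly in `ν > 0`
  have h_bound : ∀ ν, 0 < ν → ∀ᵐ p ∂(volume.restrict (Ioc (-π) π ×ˢ Ioc (-π) π)), ‖I ν p‖ ≤ M := by
    intro ν hν
    filter_upwards [ae_restrict_mem hcell, ae_goodFibre ω₂ hω] with p hp hgood
    rw [mem_prod] at hp
    obtain ⟨hne, -, hsimple⟩ := hgood
    have hsin : Real.sin ((p.2 - p.1) / 2) ≠ 0 :=
      KineticConductivityFinite.sin_half_sub_ne_zero hp.2 hp.1 (Ne.symm hne)
    have hv : groupVelocity ω₂ p.2 ≠ groupVelocity ω₂ p.1 := by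
      have h := hsimple p.2 (resonanceFn_self ω₂ p.1 p.2)
      rwa [add_sub_cancel_right] at h
    have hnn : 0 ≤ I ν p :=
      setIntegral_nonneg measurableSet_Ioc fun k₂ _ => by positivity
    rw [Real.norm_of_nonneg hnn]
    exact hM p.1 p.2 hp.1 hp.2 hsin hv ν hν
  -- (1) fibrewise convergence, a.e. on the cell² (the fibre dictionary on good fibres)
  have h_lim : ∀ᵐ p ∂(volume.restrict (Ioc (-π) π ×ˢ Ioc (-π) π)),
      Tendsto (fun ν => I ν p) (𝓝[>] 0) (𝓝 (I₀ p)) := by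
    filter_upwards [ae_restrict_mem hcell, ae_goodFibre ω₂ hω] with p hp hgood
    rw [mem_prod] at hp
    obtain ⟨hne, hπ, hsimple⟩ := hgood
    exact tendsto_fibre_lorentzian_resonantSet ω₂ a b hω f hfc p.1 p.2 hp.1 hp.2 hne hπ hsimple
  -- (4) dominated convergence
  have h_dct : Tendsto (fun ν => ∫ p in Ioc (-π) π ×ˢ Ioc (-π) π, I ν p) (𝓝[>] 0)
      (𝓝 (∫ p in Ioc (-π) π ×ˢ Ioc (-π) π, I₀ p)) :=
    tendsto_integral_filter_of_dominated_convergence (fun _ => M)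
      (eventually_nhdsWithin_of_forall fun ν hν => h_meas ν hν)
      (eventually_nhdsWithin_of_forall fun ν hν => h_bound ν hν) (integrable_const M) h_lim
  -- (5) identification of the limit
  have h_id : ∫ p in Ioc (-π) π ×ˢ Ioc (-π) π, I₀ p =
      4 * π / alsPrefactor * (boltzmannForm ω₂ a b f).toReal := by
    simp only [hI₀_def]
    rw [integral_const_mul, thresholdFGR_integral_finsum hω a b hfc.measurable]
    ring
  -- assembly
  rw [h_id] at h_dct
  have h_ev : ∀ᶠ ν in 𝓝[>] (0 : ℝ), (∫ p in Ioc (-π) π ×ˢ Ioc (-π) π, I ν p) =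
      ∫ k₁ in Ioc (-π) π, ∫ k₃ in Ioc (-π) π, I ν (k₁, k₃) :=
    eventually_nhdsWithin_of_forall fun ν hν => (h_fub ν hν).symm
  exact Tendsto.congr' h_ev h_dct

end Summit.AtomisticToContinuum.FouriersLaw.Theorems.MourreDissolution

end
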